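import Literature.NumberTheory.LFunctions.LiouvilleNonpretentious
import Literature.NumberTheory.Sieve.PretentiousDistanceProofs
import HarnessLib

/-!
# Elliott–Kish 2017, Theorem 2, Step 2: a finite-order multiplicative function constant on the
ratios `(an+1)/(An+1)` is pretentious to a fixed Dirichlet character (via Tao 2016, Thm 1.3)

Topic `Literature/NumberTheory/LFunctions`. Everything in this file is PROVED; no definitions, no
named facts. It is the first of two files (`ElliottKishRigidity`, `ElliottKishExactness`)
formalizing Steps 2–3 of the proof of

* P. D. T. A. Elliott, J. Kish, *Harmonic analysis on the positive rationals. Determination of the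
  group generated by the ratios `(an+b)/(An+B)`*, Mathematika **63** (2017) 919–943, **Theorem 2**
  (§2, pp. 923–928): a completely multiplicative `g` with `g((an+b)/(An+B)) = c ≠ 0` for all large
  `n` coincides with a Dirichlet character on the primes not dividing an explicit modulus,

in the special case `b = B = 1`, `c = 1` and for `g` OF FINITE ORDER (`g^m = 1`), which is the
input of Klurman–Kurlberg 2019, Prop. 2.1 (dense half of the classification of completely
multiplicative automatic sequences; `MultiplicativeAutomaticHolds`). For such `g` Step 1 of the
printed proof (finite order, via Elliott's book, Ch. 13) is a hypothesis, and Step 4 (the modulus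
divides `6(a,A)(aA)²Δ³`, Gauss sums) is not needed for an existential modulus.

## Contents (Step 2 of [EK]: "There is a Dirichlet character `χ` (mod `D`) and a set of primes `q`
with `∑ q⁻¹` convergent, such that `g(p) = χ(p)` on all remaining primes")

* `ElliottKish2017.exists_close_twistedChar` — [EK] Lemma 1 = Tao 2016, Thm 1.3
  (`tao_log_averaged_elliott_two`, taken as the hypothesis `hE`; proved in the tree as
  `tao_log_averaged_elliott_two_holds`) in contrapositive form: since
  `∑_{x/W<n≤x} G(an+1) conj G(An+1)/n = ∑ 1/n ≥ log(W/2)`, for every `x ≥ W` some `χ_x` mod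
  `q_x ≤ W`, `|t_x| ≤ Wx` has `𝔻(G, χ_x n^{it_x}; x)² < W`.
* `ElliottKish2017.pretentiousDistSq_one_le_ktrick` — the inequality `1 - Re z^k ≤ k²(1 - Re z)`
  of [EK] with `k = m φ(q)`: `𝔻(1, n^{ikt}; x)² ≤ 2k² 𝔻(G, χ n^{it}; x)²`.
* `ElliottKish2017.distSq_one_gt_of_two_le`, `abs_mul_log_le_of_distSq_le`,
  `distSq_one_le_of_abs_mul_log_le` — the qualitative content of [EK] Lemma 2 with `β = 0`:
  bounded `𝔻(1, n^{iu}; x)²` with `|u| ≤ x²` forces `|u| ≤ D/log x` (van der Corput's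
  `log|ζ(σ_x - iu)| ≤ log log x - B` for `2 ≤ |u| ≤ x²` and `ζ(s) = 1/(s-1) + O(1)`, both from
  `LiouvilleNonpretentious` / `PretentiousZeta`), and then `𝔻(1, n^{it}; x)² ≤ D²` (Mertens).
* `ElliottKish2017.exists_char_pretentiousDistSq_le` — the conclusion of Step 2: some character
  `χ₀` mod `q₀ ≥ 1` has `𝔻(G, χ₀; x)² ≤ R` for all `x` (triangle inequality for `𝔻`, then
  pigeonhole over the finitely many characters of modulus `≤ W` and monotonicity in `x`).

## References
* P. D. T. A. Elliott, J. Kish, Mathematika 63 (2017) 919–943, doi:10.1112/S0025579317000304,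
  §2, Steps 1–2, Lemmas 1–2 (read: held text `paper:doi-10-1112-s0025579317000304`, pp. 5–8).
  [ElliottKish2017]
* T. Tao, Forum Math. Pi 4 (2016) e8, Theorem 1.3. [TaoFMP2016]

## Design choices
* `G` is a Mathlib `ArithmeticFunction ℂ` (as required by `tao_log_averaged_elliott_two`), assumed
  multiplicative, `1`-bounded, unimodular on `n ≥ 1` and of finite order on the primes; the
  conclusion is stated with `Sieve.pretentiousDistSq` against `fun n => χ₀ n`.
* All thresholds and constants are existential; no rate is extracted.
* NOT here: Step 3 (exactness `g(p) = χ₀(p)`; file `ElliottKishExactness`), Steps 1 and 4, and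
  Theorem 1 of [EK] (the structure of the group `ℚ*/Γ`).
-/

open scoped ComplexConjugate
open Finset Real Filter

namespace Literature.NumberTheory.LFunctions

namespace ElliottKish2017

open Complex in
/-- Harmonic block lower bound: `log((N₂+1)/(N₁+1)) ≤ ∑_{N₁ < n ≤ N₂} 1/n`. [folklore] -/
theorem log_div_le_sum_Ioc_inv (N₁ N₂ : ℕ) (h : N₁ ≤ N₂) :
    Real.log (((N₂ : ℝ) + 1) / ((N₁ : ℝ) + 1)) ≤ ∑ n ∈ Ioc N₁ N₂, (1 : ℝ) / n := by
  induction N₂, h using Nat.le_induction with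
  | base => simp
  | succ N hN ih =>
    rw [← Finset.insert_Ioc_right_eq_Ioc_add_one hN, Finset.sum_insert (by simp)]
    have hN0 : (0 : ℝ) < (N : ℝ) + 1 := by positivity
    have hN1 : (0 : ℝ) < (N₁ : ℝ) + 1 := by positivity
    have hsplit : Real.log ((((N + 1 : ℕ) : ℝ) + 1) / ((N₁ : ℝ) + 1))
        = Real.log (((N : ℝ) + 1) / ((N₁ : ℝ) + 1)) + Real.log ((((N : ℝ) + 1) + 1) / ((N : ℝ) + 1)) := by
      rw [← Real.log_mul (by positivity) (by positivity)]
      congr 1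
      push_cast
      field_simp
    rw [hsplit]
    have hstep : Real.log ((((N : ℝ) + 1) + 1) / ((N : ℝ) + 1)) ≤ (1 : ℝ) / ((N + 1 : ℕ) : ℝ) := by
      have := Real.log_le_sub_one_of_pos (show (0 : ℝ) < (((N : ℝ) + 1) + 1) / ((N : ℝ) + 1) by positivity)
      calc Real.log ((((N : ℝ) + 1) + 1) / ((N : ℝ) + 1)) ≤ (((N : ℝ) + 1) + 1) / ((N : ℝ) + 1) - 1 := this
        _ = (1 : ℝ) / ((N + 1 : ℕ) : ℝ) := by push_cast; field_simp; ring
    linarith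


/-! ### Step A1: Tao's theorem, contrapositive -/

/-- **Tao's theorem forces pretentiousness.** If `G` is multiplicative, `1`-bounded, unimodular on
the progression `An+1` and `G(an+1) = G(An+1)` for all `n ≥ 1` (`a ≠ A` positive), then —
granted Tao 2016, Thm 1.3 — there is `W ≥ 4` such that for every `x ≥ W` some twisted character
`χ(n)n^{it}` of modulus `q ≤ W` with `|t| ≤ W x` has `𝔻(G, χ n^{it}; x)² < W`: otherwise the
logarithmic correlation `∑_{x/W < n ≤ x} G(an+1) conj G(An+1) / n = ∑ 1/n ≥ log(W/2)` would be
`≤ (log W)/4`. (Elliott–Kish 2017, §2, Step 2, application of Lemma 1.)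
[cite: ElliottKish2017, §2 Step 2 (Lemma 1)] -/
theorem exists_close_twistedChar (hE : tao_log_averaged_elliott_two) {a A : ℕ} (ha : 0 < a)
    (hA : 0 < A) (haA : a ≠ A) (G : ArithmeticFunction ℂ) (hGm : G.IsMultiplicative)
    (hGb : ∀ n, ‖G n‖ ≤ 1) (hGu : ∀ n, 1 ≤ n → ‖G (A * n + 1)‖ = 1)
    (hrel : ∀ n, 1 ≤ n → G (a * n + 1) = G (A * n + 1)) :
    ∃ W : ℝ, 4 ≤ W ∧ ∀ x : ℝ, W ≤ x → ∃ q : ℕ, 1 ≤ q ∧ (q : ℝ) ≤ W ∧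
      ∃ χ : DirichletCharacter ℂ q, ∃ t : ℝ, |t| ≤ W * x ∧
        Sieve.pretentiousDistSq G (Sieve.twistedChar χ t) x < W := by
  obtain ⟨A₀, hA₀⟩ := hE a A 1 1 ha hA (by simpa using haA) (1 / 4) (by norm_num)
  refine ⟨max A₀ 4, le_max_right _ _, fun x hx => ?_⟩
  set W : ℝ := max A₀ 4 with hW
  have hW4 : 4 ≤ W := le_max_right _ _
  have hW0 : 0 < W := by linarith
  have hx0 : 0 < x := by linarith
  by_contra hcon
  push Not at hcon
  -- the conjugate arithmetic function `n ↦ conj (G n)` (multiplicative, `1`-bounded)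
  let Gc : ArithmeticFunction ℂ := ⟨fun n => conj (G n), by simp⟩
  have hGc : ∀ n, Gc n = conj (G n) := fun n => rfl
  have hGcm : Gc.IsMultiplicative := by
    refine ⟨by rw [hGc, hGm.map_one, map_one], fun {m n} hmn => ?_⟩
    rw [hGc, hGc, hGc, hGm.map_mul_of_coprime hmn, map_mul]
  have key := hA₀ W (le_max_left _ _) x W le_rfl hx G Gc hGm hGcm
    hGb (fun n => by simpa [hGc] using hGb n)
    (fun q χ t hq hqW ht => hcon q hq hqW χ t ht)
  have hsum : ∑ n ∈ Ioc ⌊x / W⌋₊ ⌊x⌋₊, G (a * n + 1) * Gc (A * n + 1) / (n : ℂ)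
      = ((∑ n ∈ Ioc ⌊x / W⌋₊ ⌊x⌋₊, (1 : ℝ) / n : ℝ) : ℂ) := by
    push_cast
    refine Finset.sum_congr rfl fun n hn => ?_
    have hn1 : 1 ≤ n := Nat.succ_le_of_lt (lt_of_le_of_lt (Nat.zero_le _) (Finset.mem_Ioc.1 hn).1)
    rw [hrel n hn1, hGc, Complex.mul_conj, Complex.normSq_eq_norm_sq, hGu n hn1]
    simp
  have hnn : 0 ≤ ∑ n ∈ Ioc ⌊x / W⌋₊ ⌊x⌋₊, (1 : ℝ) / n :=
    Finset.sum_nonneg fun n _ => by positivity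
  rw [hsum, Complex.norm_real, Real.norm_of_nonneg hnn] at key
  have hN : ⌊x / W⌋₊ ≤ ⌊x⌋₊ := Nat.floor_le_floor (div_le_self hx0.le (by linarith))
  have hlow := ElliottKish2017.log_div_le_sum_Ioc_inv _ _ hN
  have h1 : x ≤ (⌊x⌋₊ : ℝ) + 1 := (Nat.lt_floor_add_one x).le
  have h2 : (⌊x / W⌋₊ : ℝ) ≤ x / W := Nat.floor_le (by positivity)
  have h3 : W / 2 ≤ ((⌊x⌋₊ : ℝ) + 1) / ((⌊x / W⌋₊ : ℝ) + 1) := by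
    rw [div_le_div_iff₀ (by norm_num) (by positivity)]
    calc W * ((⌊x / W⌋₊ : ℝ) + 1) ≤ W * (x / W + 1) := by gcongr
      _ = x + W := by field_simp
      _ ≤ ((⌊x⌋₊ : ℝ) + 1) * 2 := by linarith
  have h4 : Real.log (W / 2) ≤ Real.log (((⌊x⌋₊ : ℝ) + 1) / ((⌊x / W⌋₊ : ℝ) + 1)) :=
    Real.log_le_log (by positivity) h3
  have h5 : Real.log (W / 2) = Real.log W - Real.log 2 := Real.log_div hW0.ne' two_ne_zero
  have h6 : Real.log 4 ≤ Real.log W := Real.log_le_log (by norm_num) hW4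
  have h7 : Real.log 4 = 2 * Real.log 2 := by
    rw [show (4 : ℝ) = 2 ^ 2 by norm_num, Real.log_pow]
    norm_num
  have h8 : 0 < Real.log 2 := Real.log_pos one_lt_two
  linarith

/-! ### Step A2: the `k`-trick for a finite-order `G` -/

/-- For `‖w‖ = 1`: `1 - Re(w^k) ≤ k² (1 - Re w)`. [folklore] -/
theorem one_sub_re_pow_le {w : ℂ} (hw : ‖w‖ = 1) (k : ℕ) :
    1 - (w ^ k).re ≤ (k : ℝ) ^ 2 * (1 - w.re) := by
  have h1 := norm_one_sub_pow_le_of_norm_one hw k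
  have h2 : ‖1 - w ^ k‖ ^ 2 ≤ ((k : ℝ) * ‖1 - w‖) ^ 2 := by
    gcongr
  have hwk : ‖w ^ k‖ = 1 := by rw [norm_pow, hw, one_pow]
  rw [mul_pow, norm_one_sub_sq_of_norm_one hwk, norm_one_sub_sq_of_norm_one hw] at h2
  nlinarith [h2]

open Complex in
/-- **The `k`-trick, pointwise, for a finite-order function.** For a prime `p`, `χ` mod `q ≥ 1`,
`‖G p‖ = 1`, `G(p)^m = 1` and `k = m φ(q)`: `1 - Re p^{ikt} ≤ 2k² (1 - Re G(p) conj(χ(p)p^{it}))`.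
For `p ∤ q` this is `1 - Re w^k ≤ k²(1 - Re w)` with `w = G(p) conj(χ(p) p^{it})`, `w^k = p^{-ikt}`
(Euler); for `p ∣ q` the right side is `2k² ≥ 2`. (Elliott–Kish 2017, §2 Step 2: "The inequality
`1 - Re z^k ≤ k²(1 - Re z)`, valid in the complex unit disc".) [cite: ElliottKish2017, §2 Step 2] -/
theorem one_sub_re_cpow_le_ktrick {q : ℕ} (hq : 1 ≤ q) (χ : DirichletCharacter ℂ q) {G : ℕ → ℂ}
    {m : ℕ} (hm : 0 < m) {p : ℕ} (hp : p.Prime) (hGu : ‖G p‖ = 1) (hGpow : G p ^ m = 1) (t : ℝ) :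
    1 - ((p : ℂ) ^ (((m * q.totient : ℕ) : ℂ) * ((t : ℂ) * I))).re
      ≤ 2 * ((m * q.totient : ℕ) : ℝ) ^ 2 *
        (1 - (G p * conj (χ p * (p : ℂ) ^ ((t : ℂ) * I))).re) := by
  set k : ℕ := m * q.totient with hk
  have htot : 1 ≤ q.totient := Nat.totient_pos.2 hq
  have hk1' : 1 ≤ k := Nat.one_le_iff_ne_zero.2 (Nat.mul_ne_zero hm.ne' (by omega))
  have hk1 : (1 : ℝ) ≤ (k : ℝ) := by exact_mod_cast hk1'
  have hpt : ‖(p : ℂ) ^ ((t : ℂ) * I)‖ = 1 := by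
    rw [Complex.norm_natCast_cpow_of_pos hp.pos]
    simp
  have hpk : (p : ℂ) ^ ((k : ℂ) * ((t : ℂ) * I)) = ((p : ℂ) ^ ((t : ℂ) * I)) ^ k := cpow_nat_mul _ _ _
  have hre1 : |((p : ℂ) ^ ((k : ℂ) * ((t : ℂ) * I))).re| ≤ 1 := by
    refine (abs_re_le_norm _).trans ?_
    rw [hpk, norm_pow, hpt, one_pow]
  by_cases hu : IsUnit (p : ZMod q)
  · obtain ⟨u, hu'⟩ := hu
    have hχφ : χ (p : ZMod q) ^ q.totient = 1 := by
      rw [← hu', ← map_pow, ← Units.val_pow_eq_pow_val, ZMod.pow_totient, Units.val_one, map_one]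
    have hχk : χ (p : ZMod q) ^ k = 1 := by rw [hk, mul_comm, pow_mul, hχφ, one_pow]
    have hGk : G p ^ k = 1 := by rw [hk, pow_mul, hGpow, one_pow]
    have hχn : ‖χ (p : ZMod q)‖ = 1 := by rw [← hu']; exact χ.unit_norm_eq_one u
    set w : ℂ := G p * conj (χ p * (p : ℂ) ^ ((t : ℂ) * I)) with hw
    have hwn : ‖w‖ = 1 := by
      rw [hw, norm_mul, Complex.norm_conj, norm_mul, hGu, hχn, hpt]
      norm_num
    have hwk : w ^ k = conj ((p : ℂ) ^ ((k : ℂ) * ((t : ℂ) * I))) := by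
      rw [hw, mul_pow, ← map_pow, mul_pow, hGk, hχk, one_mul, one_mul, hpk]
    have h := one_sub_re_pow_le hwn k
    rw [hwk, Complex.conj_re] at h
    have hnn : 0 ≤ 1 - w.re := by linarith [Complex.re_le_norm w]
    nlinarith [h, hnn, sq_nonneg (k : ℝ)]
  · rw [χ.map_nonunit hu, zero_mul, map_zero, mul_zero, Complex.zero_re, sub_zero, mul_one]
    have := neg_abs_le (((p : ℂ) ^ ((k : ℂ) * ((t : ℂ) * I))).re)
    nlinarith [hre1, hk1]

open Complex in
/-- **The `k`-trick** for a finite-order `G` (`‖G p‖ = 1`, `G(p)^m = 1` on primes), `χ` mod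
`q ≥ 1`, `k = m φ(q)`: `𝔻(1, n^{ikt}; x)² ≤ 2k² · 𝔻(G, χ(n) n^{it}; x)²`.
[cite: ElliottKish2017, §2 Step 2] -/
theorem pretentiousDistSq_one_le_ktrick {q : ℕ} (hq : 1 ≤ q) (χ : DirichletCharacter ℂ q)
    {G : ℕ → ℂ} {m : ℕ} (hm : 0 < m) (hGu : ∀ p, p.Prime → ‖G p‖ = 1)
    (hGpow : ∀ p, p.Prime → G p ^ m = 1) (t x : ℝ) :
    Sieve.pretentiousDistSq 1
        (Sieve.twistedChar (1 : DirichletCharacter ℂ 1) (((m * q.totient : ℕ) : ℝ) * t)) x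
      ≤ 2 * ((m * q.totient : ℕ) : ℝ) ^ 2 * Sieve.pretentiousDistSq G (Sieve.twistedChar χ t) x := by
  unfold Sieve.pretentiousDistSq
  rw [Finset.mul_sum]
  refine Finset.sum_le_sum fun p hp => ?_
  have hpp := (Nat.mem_primesLE.1 hp).2
  have hp0 : (0 : ℝ) < p := by exact_mod_cast hpp.pos
  have e : ((((m * q.totient : ℕ) : ℝ) * t : ℝ) : ℂ) * I
      = ((m * q.totient : ℕ) : ℂ) * ((t : ℂ) * I) := by
    push_cast
    ring
  rw [Sieve.twistedChar, dirichletCharacter_modOne_apply, one_mul, Pi.one_apply, one_mul,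
    Complex.conj_re, e, ← mul_div_assoc]
  exact div_le_div_of_nonneg_right
    (one_sub_re_cpow_le_ktrick hq χ hm hpp (hGu p hpp) (hGpow p hpp) t) hp0.le

/-! ### Step A3: the three ranges of `t` -/

/-- **Large `u` is excluded.** For every `C₁` there is `x₁` with `𝔻(1, n^{iu}; x)² > C₁` whenever
`x ≥ x₁` and `2 ≤ |u| ≤ x²` ((D1c) and van der Corput's bound `log |ζ(σ_x - iu)| ≤ log log x - B`).
(Elliott–Kish 2017, §2, Lemma 2 in the qualitative form needed.) [folklore] -/
theorem distSq_one_gt_of_two_le (C₁ : ℝ) :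
    ∃ x₁ : ℝ, ∀ x : ℝ, x₁ ≤ x → ∀ u : ℝ, 2 ≤ |u| → |u| ≤ x ^ 2 →
      C₁ < Sieve.pretentiousDistSq 1 (Sieve.twistedChar (1 : DirichletCharacter ℂ 1) u) x := by
  obtain ⟨x₀, C, -, hC⟩ := exists_pretentiousDistSq_one_zeta_approx
  obtain ⟨x₁, hx₁⟩ := log_norm_zeta_sigmaX_le (C₁ + C + 1)
  refine ⟨max x₀ x₁, fun x hx u hu2 hux => ?_⟩
  have h1 := (abs_le.1 (hC x ((le_max_left _ _).trans hx) u)).1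
  have h2 := hx₁ x ((le_max_right _ _).trans hx) u hu2 hux
  linarith

open Complex in
/-- **Medium `u`: bounded distance forces `|u| ≪ 1/log x`.** For every `C₁` there are `x₂` and
`D > 0` such that `|u| ≤ 2` and `𝔻(1, n^{iu}; x)² ≤ C₁` with `x ≥ x₂` imply `|u| log x ≤ D`
((D1c) and the boundedness of `ζ(s) - 1/(s-1)` near `s = 1`: `|ζ(σ_x - iu)| ≤ M + 1/|u|`).
(Elliott–Kish 2017, §2, Lemma 2: `t_x = β + O(1/log x)`, here with `β = 0`.) [folklore] -/
theorem abs_mul_log_le_of_distSq_le (C₁ : ℝ) :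
    ∃ x₂ D : ℝ, 0 < D ∧ ∀ x : ℝ, x₂ ≤ x → ∀ u : ℝ, |u| ≤ 2 →
      Sieve.pretentiousDistSq 1 (Sieve.twistedChar (1 : DirichletCharacter ℂ 1) u) x ≤ C₁ →
        |u| * Real.log x ≤ D := by
  obtain ⟨x₀, C, hx₀, hC⟩ := exists_pretentiousDistSq_one_zeta_approx
  obtain ⟨M, hM0, hM⟩ := exists_bound_riemannZeta_sub_inv
  refine ⟨x₀, Real.exp (C₁ + C) * (M * 2 + 1), by positivity, fun x hx u hu hd => ?_⟩
  have hx3 : 3 ≤ x := hx₀.trans hx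
  have hx1 : (1 : ℝ) < x := by linarith
  have hlogx : 1 ≤ Real.log x := one_le_log_of_exp_le (Real.exp_one_lt_three.le.trans hx3)
  have hlog0 : 0 < Real.log x := by linarith
  rcases eq_or_ne u 0 with rfl | hu0
  · rw [abs_zero, zero_mul]
    positivity
  have hu0' : 0 < |u| := abs_pos.2 hu0
  set s : ℂ := (sigmaX x : ℂ) - u * I with hs
  have hsre : s.re = sigmaX x := by simp [hs]
  have hsim : s.im = -u := by simp [hs]
  have hσ1 := one_lt_sigmaX hx1
  have hσ2 := sigmaX_le_two (Real.exp_one_lt_three.le.trans hx3)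
  have hs1 : s ≠ 1 := fun h => by
    have := congrArg Complex.im h
    rw [hsim, Complex.one_im, neg_eq_zero] at this
    exact hu0 this
  have hζ := hM s (by rw [hsre]; exact hσ1.le) (by rw [hsre]; exact hσ2)
    (by rw [hsim, abs_neg]; exact hu) hs1
  have hinv : ‖(s - 1)⁻¹‖ ≤ 1 / |u| := by
    rw [norm_inv, one_div]
    have him : |u| ≤ ‖s - 1‖ := by
      have := Complex.abs_im_le_norm (s - 1)
      rwa [Complex.sub_im, Complex.one_im, sub_zero, hsim, abs_neg] at this
    exact inv_anti₀ hu0' him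
  have hζle : ‖riemannZeta s‖ ≤ M + 1 / |u| := by
    calc ‖riemannZeta s‖ = ‖(riemannZeta s - (s - 1)⁻¹) + (s - 1)⁻¹‖ := by rw [sub_add_cancel]
      _ ≤ ‖riemannZeta s - (s - 1)⁻¹‖ + ‖(s - 1)⁻¹‖ := norm_add_le _ _
      _ ≤ M + 1 / |u| := add_le_add hζ hinv
  have hζpos : 0 < ‖riemannZeta s‖ :=
    norm_pos_iff.2 (riemannZeta_ne_zero_of_one_lt_re (by rw [hsre]; exact hσ1))
  have hMu : 0 < M + 1 / |u| := by positivity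
  have hlogζ : Real.log ‖riemannZeta s‖ ≤ Real.log (M + 1 / |u|) := Real.log_le_log hζpos hζle
  have h1 := (abs_le.1 (hC x hx u)).1
  have h2 : Real.log (Real.log x) ≤ C₁ + C + Real.log (M + 1 / |u|) := by linarith
  have h3 : Real.log x ≤ Real.exp (C₁ + C) * (M + 1 / |u|) := by
    have := Real.exp_le_exp.2 h2
    rwa [Real.exp_log hlog0, Real.exp_add, Real.exp_log hMu] at this
  calc |u| * Real.log x ≤ |u| * (Real.exp (C₁ + C) * (M + 1 / |u|)) := by gcongr
    _ = Real.exp (C₁ + C) * (M * |u| + 1) := by field_simp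
    _ ≤ Real.exp (C₁ + C) * (M * 2 + 1) := by gcongr

open Complex in
/-- **Tiny `t`: `|t| log x ≤ D` gives `𝔻(1, n^{it}; x)² ≤ D²`** (`1 - cos θ ≤ θ²/2` and Mertens'
`∑_{p ≤ x} log p / p ≤ log x + log 4`). (Elliott–Kish 2017, §2 Step 2: the sums with `t_x`
replaced by `β` differ by `≪ ∑ p⁻¹ |t_x - β| log p ≪ 1`.) [folklore] -/
theorem distSq_one_le_of_abs_mul_log_le {D : ℝ} {x : ℝ} (hx : 4 ≤ x) {t : ℝ}
    (ht : |t| * Real.log x ≤ D) :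
    Sieve.pretentiousDistSq 1 (Sieve.twistedChar (1 : DirichletCharacter ℂ 1) t) x ≤ D ^ 2 := by
  have hx0 : 0 < x := by linarith
  have hlog4 : Real.log 4 ≤ Real.log x := Real.log_le_log (by norm_num) hx
  have hlog40 : 0 < Real.log 4 := Real.log_pos (by norm_num)
  have hlogx : 0 < Real.log x := by linarith
  have hfl : Real.log (⌊x⌋₊ : ℝ) ≤ Real.log x := by
    have h4 : (4 : ℝ) ≤ ⌊x⌋₊ := by exact_mod_cast Nat.le_floor (by exact_mod_cast hx)
    exact Real.log_le_log (by linarith) (Nat.floor_le hx0.le)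
  unfold Sieve.pretentiousDistSq
  have hbound : ∀ p ∈ Nat.primesLE ⌊x⌋₊,
      (1 - ((1 : ℕ → ℂ) p * conj (Sieve.twistedChar (1 : DirichletCharacter ℂ 1) t p)).re) / (p : ℝ)
        ≤ (t ^ 2 * Real.log x / 2) * (Real.log p / p) := by
    intro p hp
    obtain ⟨hpx, hpp⟩ := Nat.mem_primesLE.1 hp
    have hp0 : (0 : ℝ) < p := by exact_mod_cast hpp.pos
    rw [Sieve.twistedChar, dirichletCharacter_modOne_apply, one_mul, Pi.one_apply, one_mul,
      Complex.conj_re, re_natCast_cpow_mul_I hpp.pos]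
    have hcos : 1 - Real.cos (t * Real.log p) ≤ (t * Real.log p) ^ 2 / 2 := by
      linarith [Real.one_sub_sq_div_two_le_cos (x := t * Real.log p)]
    have hlogp : Real.log p ≤ Real.log x :=
      Real.log_le_log hp0 (le_trans (by exact_mod_cast hpx) (Nat.floor_le hx0.le))
    have hlogp0 : 0 ≤ Real.log p := Real.log_nonneg (by exact_mod_cast hpp.one_lt.le)
    calc (1 - Real.cos (t * Real.log p)) / (p : ℝ) ≤ ((t * Real.log p) ^ 2 / 2) / p := by gcongr
      _ = (t ^ 2 * Real.log p / 2) * (Real.log p / p) := by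
          field_simp
      _ ≤ (t ^ 2 * Real.log x / 2) * (Real.log p / p) := by gcongr
  have ht2 : 0 ≤ t ^ 2 * Real.log x / 2 := by positivity
  calc ∑ p ∈ Nat.primesLE ⌊x⌋₊,
        (1 - ((1 : ℕ → ℂ) p * conj (Sieve.twistedChar (1 : DirichletCharacter ℂ 1) t p)).re) / (p : ℝ)
      ≤ ∑ p ∈ Nat.primesLE ⌊x⌋₊, (t ^ 2 * Real.log x / 2) * (Real.log p / p) := Finset.sum_le_sum hbound
    _ = (t ^ 2 * Real.log x / 2) * ∑ p ∈ Nat.primesLE ⌊x⌋₊, Real.log p / p := by rw [Finset.mul_sum]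
    _ ≤ (t ^ 2 * Real.log x / 2) * (Real.log (⌊x⌋₊ : ℝ) + Real.log 4) := by
        gcongr
        exact MertensBound.sum_log_div_prime_le ⌊x⌋₊
    _ ≤ (t ^ 2 * Real.log x / 2) * (Real.log x + Real.log x) := by gcongr
    _ = (|t| * Real.log x) ^ 2 := by rw [mul_pow, sq_abs]; ring
    _ ≤ D ^ 2 := by gcongr


/-! ### Steps A4–A5: a fixed character at bounded distance -/

open Complex in
/-- `𝔻(χ(n)n^{it}, χ; x)² ≤ 𝔻(1, n^{it}; x)² + q`: on the primes `p ∤ q` the summands coincide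
(`|χ(p)| = 1`), and the primes dividing `q ≥ 1` contribute at most `1` each. [folklore] -/
theorem pretentiousDistSq_twistedChar_char_le {q : ℕ} (hq : 1 ≤ q) (χ : DirichletCharacter ℂ q)
    (t x : ℝ) :
    Sieve.pretentiousDistSq (Sieve.twistedChar χ t) (fun n => χ n) x
      ≤ Sieve.pretentiousDistSq 1 (Sieve.twistedChar (1 : DirichletCharacter ℂ 1) t) x + q := by
  unfold Sieve.pretentiousDistSq
  have hpt : ∀ {p : ℕ}, p.Prime →
      (1 - ((1 : ℕ → ℂ) p * conj (Sieve.twistedChar (1 : DirichletCharacter ℂ 1) t p)).re) / (p : ℝ)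
        = (1 - ((p : ℂ) ^ ((t : ℂ) * I)).re) / p := by
    intro p hp
    rw [Sieve.twistedChar, dirichletCharacter_modOne_apply, one_mul, Pi.one_apply, one_mul,
      Complex.conj_re]
  have hbound : ∀ p ∈ Nat.primesLE ⌊x⌋₊,
      (1 - (Sieve.twistedChar χ t p * conj (χ p)).re) / (p : ℝ)
        ≤ (1 - ((1 : ℕ → ℂ) p * conj (Sieve.twistedChar (1 : DirichletCharacter ℂ 1) t p)).re) / (p : ℝ)
          + (if p ∣ q then (1 : ℝ) else 0) := by
    intro p hp
    have hpp := (Nat.mem_primesLE.1 hp).2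
    have hp0 : (0 : ℝ) < p := by exact_mod_cast hpp.pos
    have hp1 : (1 : ℝ) ≤ p := by exact_mod_cast hpp.one_lt.le
    have hptn : ‖(p : ℂ) ^ ((t : ℂ) * I)‖ = 1 := by
      rw [Complex.norm_natCast_cpow_of_pos hpp.pos]
      simp
    rw [hpt hpp]
    by_cases hu : IsUnit (p : ZMod q)
    · obtain ⟨u, hu'⟩ := hu
      have hχn : ‖χ (p : ZMod q)‖ = 1 := by rw [← hu']; exact χ.unit_norm_eq_one u
      have hmul : Sieve.twistedChar χ t p * conj (χ p) = (p : ℂ) ^ ((t : ℂ) * I) := by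
        rw [Sieve.twistedChar]
        have : χ (p : ZMod q) * conj (χ (p : ZMod q)) = 1 := by
          rw [Complex.mul_conj, Complex.normSq_eq_norm_sq, hχn]
          norm_num
        calc χ (p : ZMod q) * (p : ℂ) ^ ((t : ℂ) * I) * conj (χ (p : ZMod q))
            = (χ (p : ZMod q) * conj (χ (p : ZMod q))) * (p : ℂ) ^ ((t : ℂ) * I) := by ring
          _ = (p : ℂ) ^ ((t : ℂ) * I) := by rw [this, one_mul]
      rw [hmul]
      have : (0 : ℝ) ≤ if p ∣ q then (1 : ℝ) else 0 := by split_ifs <;> norm_num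
      linarith
    · have hdvd : p ∣ q := by
        by_contra hnd
        exact hu ((ZMod.isUnit_prime_iff_not_dvd hpp).2 hnd)
      rw [if_pos hdvd, χ.map_nonunit hu, map_zero, mul_zero, Complex.zero_re, sub_zero]
      have hre : ((p : ℂ) ^ ((t : ℂ) * I)).re ≤ 1 := (Complex.re_le_norm _).trans hptn.le
      have h1 : (1 : ℝ) / p ≤ 1 := by rw [div_le_one hp0]; exact hp1
      have h2 : 0 ≤ (1 - ((p : ℂ) ^ ((t : ℂ) * I)).re) / (p : ℝ) := div_nonneg (by linarith) hp0.le
      linarith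
  refine (Finset.sum_le_sum hbound).trans ?_
  rw [Finset.sum_add_distrib]
  gcongr
  rw [Finset.sum_ite, Finset.sum_const_zero, add_zero, Finset.sum_const, nsmul_eq_mul, mul_one]
  have hsub : (Nat.primesLE ⌊x⌋₊).filter (fun p => p ∣ q) ⊆ q.divisors := by
    intro p hp
    rw [Finset.mem_filter] at hp
    exact Nat.mem_divisors.2 ⟨hp.2, by omega⟩
  exact_mod_cast (Finset.card_le_card hsub).trans (Nat.card_divisors_le_self q)

/-- **Elliott–Kish 2017, Theorem 2, Step 2, for finite-order functions** (granted Tao 2016,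
Thm 1.3). Let `G` be a multiplicative, `1`-bounded arithmetic function, unimodular on the positive
integers and of finite order on the primes (`G(p)^m = 1`), with `G(an+1) = G(An+1)` for all
`n ≥ 1`, where `a ≠ A` are positive. Then there is a Dirichlet character `χ` (mod `q`) such that
the distances `𝔻(G, χ; x)² = ∑_{p ≤ x} (1 - Re G(p) conj χ(p)) / p` are bounded uniformly in `x`
("the sums … are uniformly bounded and, since there are only finitely many possibilities for the
character, for some character the corresponding infinite series converges").
Proof: Step A1 (Tao) gives, for each large `x`, `χ_x` mod `q_x ≤ W` and `|t_x| ≤ Wx` with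
`𝔻(G, χ_x n^{it_x}; x)² < W`; the `k`-trick with `k = m φ(q_x)` bounds `𝔻(1, n^{ikt_x}; x)²`, so
`|k t_x| < 2` (van der Corput) and then `|t_x| log x ≤ D` (`ζ(s) ~ 1/(s-1)`), whence
`𝔻(1, n^{it_x}; x)² ≤ D²`, `𝔻(χ_x n^{it_x}, χ_x; x)² ≤ D² + W`, and by the triangle inequality
`𝔻(G, χ_x; x) ≤ √W + √(D² + W)`; finally pigeonhole over the finitely many characters of modulus
`≤ W` and monotonicity in `x`. [cite: ElliottKish2017, Theorem 2 (§2, Step 2)] -/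
theorem exists_char_pretentiousDistSq_le (hE : tao_log_averaged_elliott_two) {a A : ℕ}
    (ha : 0 < a) (hA : 0 < A) (haA : a ≠ A) (G : ArithmeticFunction ℂ) (hGm : G.IsMultiplicative)
    (hGb : ∀ n, ‖G n‖ ≤ 1) (hGu : ∀ n, 1 ≤ n → ‖G n‖ = 1) {m : ℕ} (hm : 0 < m)
    (hGpow : ∀ p, p.Prime → G p ^ m = 1) (hrel : ∀ n, 1 ≤ n → G (a * n + 1) = G (A * n + 1)) :
    ∃ q : ℕ, 1 ≤ q ∧ ∃ χ : DirichletCharacter ℂ q, ∃ R : ℝ, ∀ x : ℝ,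
      Sieve.pretentiousDistSq G (fun n => χ n) x ≤ R := by
  obtain ⟨W, hW4, hWx⟩ := exists_close_twistedChar hE ha hA haA G hGm hGb
    (fun n _ => hGu _ (Nat.succ_le_succ (Nat.zero_le _))) hrel
  have hW0 : 0 < W := by linarith
  have hW1 : 1 ≤ W := by linarith
  set C₁ : ℝ := 2 * ((m : ℝ) * W) ^ 2 * W with hC₁
  obtain ⟨x₁, hx₁⟩ := distSq_one_gt_of_two_le C₁
  obtain ⟨x₂, D, hD, hx₂⟩ := abs_mul_log_le_of_distSq_le C₁
  set R₀ : ℝ := (Real.sqrt W + Real.sqrt (D ^ 2 + W)) ^ 2 with hR₀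
  set X₀ : ℝ := max (max W (m * W ^ 2)) (max x₁ x₂) with hX₀
  have hχb : ∀ {q : ℕ} (χ : DirichletCharacter ℂ q) (n : ℕ), ‖(fun n : ℕ => χ n) n‖ ≤ 1 :=
    fun χ n => χ.norm_le_one n
  -- A4: at every large `x` some character of modulus `≤ W` is within `R₀`
  have A4 : ∀ x : ℝ, X₀ ≤ x → ∃ q : ℕ, 1 ≤ q ∧ (q : ℝ) ≤ W ∧ ∃ χ : DirichletCharacter ℂ q,
      Sieve.pretentiousDistSq G (fun n => χ n) x ≤ R₀ := by
    intro x hx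
    have hxW : W ≤ x := ((le_max_left _ _).trans (le_max_left _ _)).trans hx
    have hxm : (m : ℝ) * W ^ 2 ≤ x := ((le_max_right _ _).trans (le_max_left _ _)).trans hx
    have hxx₁ : x₁ ≤ x := ((le_max_left _ _).trans (le_max_right _ _)).trans hx
    have hxx₂ : x₂ ≤ x := ((le_max_right _ _).trans (le_max_right _ _)).trans hx
    have hx4 : 4 ≤ x := hW4.trans hxW
    have hx0 : 0 < x := by linarith
    obtain ⟨q, hq1, hqW, χ, t, ht, hdist⟩ := hWx x hxW
    refine ⟨q, hq1, hqW, χ, ?_⟩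
    set k : ℕ := m * q.totient with hk
    have htot : 1 ≤ q.totient := Nat.totient_pos.2 hq1
    have hk1' : 1 ≤ k := Nat.one_le_iff_ne_zero.2 (Nat.mul_ne_zero hm.ne' (by omega))
    have hk1 : (1 : ℝ) ≤ k := by exact_mod_cast hk1'
    have hk0 : (0 : ℝ) < k := by linarith
    have hkW : (k : ℝ) ≤ m * W := by
      have h1 : (q.totient : ℝ) ≤ q := by exact_mod_cast Nat.totient_le q
      rw [hk]
      push_cast
      exact mul_le_mul_of_nonneg_left (h1.trans hqW) (Nat.cast_nonneg m)
    have hGu' : ∀ p : ℕ, p.Prime → ‖G p‖ = 1 := fun p hp => hGu p hp.one_lt.le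
    have hkt := pretentiousDistSq_one_le_ktrick hq1 χ hm hGu' hGpow t x
    have hu_le : Sieve.pretentiousDistSq 1
        (Sieve.twistedChar (1 : DirichletCharacter ℂ 1) ((k : ℝ) * t)) x ≤ C₁ := by
      refine hkt.trans ?_
      rw [hC₁]
      have h2 : ((k : ℕ) : ℝ) ^ 2 ≤ ((m : ℝ) * W) ^ 2 := by gcongr
      have h3 : 0 ≤ Sieve.pretentiousDistSq (⇑G) (Sieve.twistedChar χ t) x :=
        Sieve.pretentiousDistSq_nonneg hGb (Sieve.norm_twistedChar_le_one χ t) x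
      calc 2 * ((k : ℕ) : ℝ) ^ 2 * Sieve.pretentiousDistSq (⇑G) (Sieve.twistedChar χ t) x
          ≤ 2 * ((m : ℝ) * W) ^ 2 * Sieve.pretentiousDistSq (⇑G) (Sieve.twistedChar χ t) x := by
            gcongr
        _ ≤ 2 * ((m : ℝ) * W) ^ 2 * W := by gcongr
    have habs_u : |(k : ℝ) * t| ≤ x ^ 2 := by
      rw [abs_mul, abs_of_pos hk0]
      calc (k : ℝ) * |t| ≤ (m * W) * (W * x) := mul_le_mul hkW ht (abs_nonneg _) (by positivity)
        _ = (m * W ^ 2) * x := by ring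
        _ ≤ x * x := by gcongr
        _ = x ^ 2 := (sq x).symm
    have hu2 : |(k : ℝ) * t| < 2 := by
      by_contra h
      push Not at h
      exact absurd hu_le (not_le.2 (hx₁ x hxx₁ _ h habs_u))
    have hsmall := hx₂ x hxx₂ ((k : ℝ) * t) hu2.le hu_le
    have ht_small : |t| * Real.log x ≤ D := by
      have hlog0 : 0 ≤ Real.log x := Real.log_nonneg (by linarith)
      calc |t| * Real.log x ≤ |(k : ℝ) * t| * Real.log x := by
            rw [abs_mul, abs_of_pos hk0]
            gcongr
            exact le_mul_of_one_le_left (abs_nonneg t) hk1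
        _ ≤ D := hsmall
    have hZ3 := distSq_one_le_of_abs_mul_log_le hx4 ht_small
    have hmid : Sieve.pretentiousDistSq (Sieve.twistedChar χ t) (fun n => χ n) x ≤ D ^ 2 + W :=
      (pretentiousDistSq_twistedChar_char_le hq1 χ t x).trans (by linarith)
    have htri := Sieve.pretentiousDist_triangle_holds (f := (⇑G : ℕ → ℂ))
      (g := Sieve.twistedChar χ t) (h := fun n => χ n) hGb (Sieve.norm_twistedChar_le_one χ t)
      (hχb χ) x
    unfold Sieve.pretentiousDist at htri
    have hs1 : Real.sqrt (Sieve.pretentiousDistSq (⇑G) (Sieve.twistedChar χ t) x) ≤ Real.sqrt W :=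
      Real.sqrt_le_sqrt hdist.le
    have hs2 : Real.sqrt (Sieve.pretentiousDistSq (Sieve.twistedChar χ t) (fun n => χ n) x)
        ≤ Real.sqrt (D ^ 2 + W) := Real.sqrt_le_sqrt hmid
    have hnn : 0 ≤ Sieve.pretentiousDistSq (⇑G) (fun n => χ n) x :=
      Sieve.pretentiousDistSq_nonneg hGb (hχb χ) x
    have hsq : Real.sqrt (Sieve.pretentiousDistSq (⇑G) (fun n => χ n) x)
        ≤ Real.sqrt W + Real.sqrt (D ^ 2 + W) := by linarith
    calc Sieve.pretentiousDistSq (⇑G) (fun n => χ n) x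
        = (Real.sqrt (Sieve.pretentiousDistSq (⇑G) (fun n => χ n) x)) ^ 2 := (Real.sq_sqrt hnn).symm
      _ ≤ (Real.sqrt W + Real.sqrt (D ^ 2 + W)) ^ 2 := by
          gcongr
  -- A5: pigeonhole over the finitely many characters of modulus `≤ W`
  by_contra hnone
  push Not at hnone
  have hev : ∀ i : (Σ q : {q : ℕ // q ∈ Finset.Icc 1 ⌊W⌋₊}, DirichletCharacter ℂ (q : ℕ)),
      ∀ᶠ x : ℝ in atTop, R₀ < Sieve.pretentiousDistSq G (fun n => i.2 n) x := by
    rintro ⟨⟨q, hq⟩, χ⟩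
    obtain ⟨x₀, hx₀⟩ := hnone q (Finset.mem_Icc.1 hq).1 χ R₀
    filter_upwards [eventually_ge_atTop x₀] with x hx
    exact hx₀.trans_le (Sieve.pretentiousDistSq_mono hGb (hχb χ) hx)
  obtain ⟨x, hx, hxX⟩ := ((eventually_all.2 hev).and (eventually_ge_atTop X₀)).exists
  obtain ⟨q, hq1, hqW, χ, hχ⟩ := A4 x hxX
  have hqmem : q ∈ Finset.Icc 1 ⌊W⌋₊ := Finset.mem_Icc.2 ⟨hq1, Nat.le_floor hqW⟩
  exact absurd hχ (not_le.2 (hx ⟨⟨q, hqmem⟩, χ⟩))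


end ElliottKish2017

end Literature.NumberTheory.LFunctions
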